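import Summits.Ventures.PercRepro.RankLevelSetRuleQSliceTailMono

/-!
# PercRepro — THE PRODUCT OF THE DECAY FACTORS IN CLOSED FORM; THE GAP CELLS FROM ONE NUMBER PER FAMILY
(night-1, gen 21; dossier §32)

Iterating `T(m+1) ≤ f(M)·T(m)` (`borderTail_succ_le`, `f(M) = M(M+2R+2)/((M+R)(M+R+1))`, `R = K+2`, `M = m+K+1`) from `m = 3`:
* **`decayProd R M₀ M`** `= Π_{M' = M₀}^{M−1} f(M')` in CLOSED FORM, `Π_{i<R} (M₀+i)/(M+i) · Π_{i≤R} (M+R+1+i)/(M₀+R+1+i)`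
  (`decayProd_succ`: the step is `f(M)`, by the telescoping `prod_shift_ratio`);
* **`borderTail_le_three_mul_decay`** — `T(m, K) ≤ T(3, K) · decayProd (K+2) (K+4) (m+K+1)` for every `m ≥ 3`;
* **`decay_Z_mono`** — `Z(M) := M · decayProd R M₀ M` is nondecreasing in `M` once `(R−2)(R+1) ≤ 2M` (the ratio
  `(M+1)f(M)/M = (M+1)(M+2R+2)/((M+R)(M+R+1)) ≥ 1` exactly there);
Hence (RankLevelSetRuleQSliceBorderAll, `phiK_le_rhat_gap_of_Z`) a cell beyond the density range (`K(K+1) < 2m`, so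
`K(K+3) ≤ 2M`) with `m + K + 1 ≤ M_b` is paid as soon as `(18/5)·M_b·decayProd (K+2) (K+4) M_b ≤ (K+1)(K−1)`: the path bound
`T ≤ (K+1)(K−1)/(4(m+K+1))` of `phiK_le_rhat_border_of_tail` follows from `T ≤ (9/10)·decayProd` and the monotonicity of `Z` —
every gap family `11 ≤ k ≤ 19` (`k(k−3)/2 ≤ q < q₁(k)`) closes from ONE rational inequality at `M_b = q₁(k)`.
Twin: mining/night-1/g21/gapcells.py (exact: the closed form = the product, `Z` monotone on every gap range, all 421 cells).
Axioms: standard.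
-/

namespace PercRepro

open Finset

/-- The product of the decay factors `Π_{M' = M₀}^{M−1} M'(M'+2R+2)/((M'+R)(M'+R+1))` in closed form:
`Π_{i<R} (M₀+i)/(M+i) · Π_{i≤R} (M+R+1+i)/(M₀+R+1+i)`. -/
def decayProd (R M₀ M : ℕ) : ℚ :=
  (∏ i ∈ range R, (((M₀ : ℚ) + i) / ((M : ℚ) + i)))
    * ∏ i ∈ range (R + 1), (((M : ℚ) + R + 1 + i) / ((M₀ : ℚ) + R + 1 + i))

/-- `decayProd` is nonnegative. -/
lemma decayProd_nonneg (R M₀ M : ℕ) : 0 ≤ decayProd R M₀ M := by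
  unfold decayProd
  apply mul_nonneg <;> exact Finset.prod_nonneg (fun i _ => by positivity)

/-- The empty product: `decayProd R M₀ M₀ = 1` (`0 < M₀`). -/
lemma decayProd_self (R M₀ : ℕ) (h : 0 < M₀) : decayProd R M₀ M₀ = 1 := by
  unfold decayProd
  have h1 : ∏ i ∈ range R, (((M₀ : ℚ) + i) / ((M₀ : ℚ) + i)) = 1 := by
    apply Finset.prod_eq_one
    intro i _
    have : (0 : ℚ) < (M₀ : ℚ) + i := by
      have : (1 : ℚ) ≤ M₀ := by exact_mod_cast h
      positivity
    exact div_self this.ne'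
  have h2 : ∏ i ∈ range (R + 1), (((M₀ : ℚ) + R + 1 + i) / ((M₀ : ℚ) + R + 1 + i)) = 1 := by
    apply Finset.prod_eq_one
    intro i _
    exact div_self (by positivity)
  rw [h1, h2, mul_one]

/-- The telescoping product `Π_{i<n} (x+i)/(x+1+i) = x/(x+n)` (`0 < x`). -/
lemma prod_shift_ratio (x : ℚ) (hx : 0 < x) (n : ℕ) :
    ∏ i ∈ range n, ((x + i) / (x + 1 + i)) = x / (x + n) := by
  induction n with
  | zero => simp [hx.ne']
  | succ n ih =>
    rw [Finset.prod_range_succ, ih]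
    have h1 : (0 : ℚ) < x + n := by positivity
    have h2 : (0 : ℚ) < x + 1 + n := by positivity
    push_cast
    field_simp
    ring

/-- The telescoping product `Π_{i<n} (x+1+i)/(x+i) = (x+n)/x` (`0 < x`). -/
lemma prod_shift_ratio' (x : ℚ) (hx : 0 < x) (n : ℕ) :
    ∏ i ∈ range n, ((x + 1 + i) / (x + i)) = (x + n) / x := by
  induction n with
  | zero => simp [hx.ne']
  | succ n ih =>
    rw [Finset.prod_range_succ, ih]
    have h1 : (0 : ℚ) < x + n := by positivity
    push_cast
    field_simp
    ring

/-- **The step of the closed form**: `decayProd R M₀ (M+1) = decayProd R M₀ M · M(M+2R+2)/((M+R)(M+R+1))` (`0 < M`). -/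
lemma decayProd_succ (R M₀ M : ℕ) (hM : 0 < M) :
    decayProd R M₀ (M + 1)
      = decayProd R M₀ M * (((M : ℚ) * ((M : ℚ) + 2 * R + 2)) / (((M : ℚ) + R) * ((M : ℚ) + R + 1))) := by
  unfold decayProd
  have hM' : (0 : ℚ) < M := by exact_mod_cast hM
  -- first product: Π (M₀+i)/(M+1+i) = Π (M₀+i)/(M+i) · Π (M+i)/(M+1+i)
  have e1 : ∏ i ∈ range R, (((M₀ : ℚ) + i) / (((M + 1 : ℕ) : ℚ) + i))
      = (∏ i ∈ range R, (((M₀ : ℚ) + i) / ((M : ℚ) + i))) * ∏ i ∈ range R, (((M : ℚ) + i) / ((M : ℚ) + 1 + i)) := by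
    rw [← Finset.prod_mul_distrib]
    refine Finset.prod_congr rfl (fun i _ => ?_)
    have : (0 : ℚ) < (M : ℚ) + i := by positivity
    push_cast
    field_simp
  -- second product: Π (M+1+R+1+i)/(M₀+R+1+i) = Π (M+R+1+i)/(M₀+R+1+i) · Π (M+R+1+1+i)/(M+R+1+i)
  have e2 : ∏ i ∈ range (R + 1), ((((M + 1 : ℕ) : ℚ) + R + 1 + i) / ((M₀ : ℚ) + R + 1 + i))
      = (∏ i ∈ range (R + 1), (((M : ℚ) + R + 1 + i) / ((M₀ : ℚ) + R + 1 + i)))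
        * ∏ i ∈ range (R + 1), ((((M : ℚ) + R + 1) + 1 + i) / (((M : ℚ) + R + 1) + i)) := by
    rw [← Finset.prod_mul_distrib]
    refine Finset.prod_congr rfl (fun i _ => ?_)
    have : (0 : ℚ) < (M : ℚ) + R + 1 + i := by positivity
    push_cast
    field_simp
    ring
  rw [e1, e2, prod_shift_ratio (M : ℚ) hM' R, prod_shift_ratio' ((M : ℚ) + R + 1) (by positivity) (R + 1)]
  push_cast
  have h1 : (0 : ℚ) < (M : ℚ) + R := by positivity
  have h2 : (0 : ℚ) < (M : ℚ) + R + 1 := by positivity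
  field_simp
  ring

/-- **`T(m, K) ≤ T(3, K) · decayProd (K+2) (K+4) (m+K+1)`** for every `m ≥ 3` (iterating `borderTail_succ_le`). -/
theorem borderTail_le_three_mul_decay (K m : ℕ) (h3 : 3 ≤ m) :
    borderTail m K ≤ borderTail 3 K * decayProd (K + 2) (K + 4) (m + K + 1) := by
  obtain ⟨d, rfl⟩ : ∃ d, m = 3 + d := ⟨m - 3, by omega⟩
  induction d with
  | zero =>
    rw [show 3 + 0 + K + 1 = K + 4 by ring, decayProd_self (K + 2) (K + 4) (by omega), mul_one]
  | succ d ih =>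
    have ih' := ih (by omega)
    have hstep := borderTail_succ_le (3 + d) K
    have hP := decayProd_succ (K + 2) (K + 4) (3 + d + K + 1) (by omega)
    have hf : (0 : ℚ) ≤ (((3 + d : ℕ) : ℚ) + K + 1) * (((3 + d : ℕ) : ℚ) + 3 * K + 7)
        / ((((3 + d : ℕ) : ℚ) + 2 * K + 3) * (((3 + d : ℕ) : ℚ) + 2 * K + 4)) := by positivity
    have hT3 : 0 ≤ borderTail 3 K := borderTail_nonneg 3 K
    calc borderTail (3 + (d + 1)) K = borderTail (3 + d + 1) K := by rw [Nat.add_assoc]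
      _ ≤ (((3 + d : ℕ) : ℚ) + K + 1) * (((3 + d : ℕ) : ℚ) + 3 * K + 7)
            / ((((3 + d : ℕ) : ℚ) + 2 * K + 3) * (((3 + d : ℕ) : ℚ) + 2 * K + 4)) * borderTail (3 + d) K := hstep
      _ ≤ (((3 + d : ℕ) : ℚ) + K + 1) * (((3 + d : ℕ) : ℚ) + 3 * K + 7)
            / ((((3 + d : ℕ) : ℚ) + 2 * K + 3) * (((3 + d : ℕ) : ℚ) + 2 * K + 4))
            * (borderTail 3 K * decayProd (K + 2) (K + 4) (3 + d + K + 1)) := mul_le_mul_of_nonneg_left ih' hf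
      _ = borderTail 3 K * (decayProd (K + 2) (K + 4) (3 + d + K + 1)
            * ((((3 + d + K + 1 : ℕ) : ℚ) * (((3 + d + K + 1 : ℕ) : ℚ) + 2 * (K + 2 : ℕ) + 2))
              / (((((3 + d + K + 1 : ℕ) : ℚ) + (K + 2 : ℕ)) * (((3 + d + K + 1 : ℕ) : ℚ) + (K + 2 : ℕ) + 1))))) := by
          push_cast; ring
      _ = borderTail 3 K * decayProd (K + 2) (K + 4) (3 + d + K + 1 + 1) := by rw [hP]
      _ = borderTail 3 K * decayProd (K + 2) (K + 4) (3 + (d + 1) + K + 1) := by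
          rw [show 3 + (d + 1) + K + 1 = 3 + d + K + 1 + 1 by ring]

/-- **`Z(M) = M · decayProd R M₀ M` steps up** once `(R−2)(R+1) ≤ 2M` (with `2 ≤ R`, `0 < M`):
`(M+1)·f(M) ≥ M ⟺ (M+1)(M+2R+2) ≥ (M+R)(M+R+1) ⟺ 2M + 2R + 2 ≥ R² + R`. -/
lemma decay_Z_step (R M₀ M : ℕ) (hR : 2 ≤ R) (hM : 0 < M) (h : (R - 2) * (R + 1) ≤ 2 * M) :
    (M : ℚ) * decayProd R M₀ M ≤ ((M + 1 : ℕ) : ℚ) * decayProd R M₀ (M + 1) := by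
  rw [decayProd_succ R M₀ M hM]
  have hP := decayProd_nonneg R M₀ M
  have hM' : (0 : ℚ) < M := by exact_mod_cast hM
  have hR' : (2 : ℚ) ≤ R := by exact_mod_cast hR
  have hh : ((R : ℚ) - 2) * ((R : ℚ) + 1) ≤ 2 * M := by
    have := h
    rw [← Nat.cast_le (α := ℚ)] at this
    push_cast [Nat.cast_sub hR] at this
    exact this
  have hD : (0 : ℚ) < ((M : ℚ) + R) * ((M : ℚ) + R + 1) := by positivity
  -- (M+1) f(M) ≥ M
  have hf : (M : ℚ) ≤ ((M : ℚ) + 1) * (((M : ℚ) * ((M : ℚ) + 2 * R + 2)) / (((M : ℚ) + R) * ((M : ℚ) + R + 1))) := by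
    rw [← mul_div_assoc, le_div_iff₀ hD]
    nlinarith
  push_cast
  calc (M : ℚ) * decayProd R M₀ M
      ≤ (((M : ℚ) + 1) * (((M : ℚ) * ((M : ℚ) + 2 * R + 2)) / (((M : ℚ) + R) * ((M : ℚ) + R + 1)))) * decayProd R M₀ M :=
        mul_le_mul_of_nonneg_right hf hP
    _ = _ := by ring

/-- **`Z` is nondecreasing**: `(R−2)(R+1) ≤ 2M`, `0 < M`, `M ≤ M'` ⇒ `M · decayProd R M₀ M ≤ M' · decayProd R M₀ M'`. -/
lemma decay_Z_mono (R M₀ M M' : ℕ) (hR : 2 ≤ R) (hM : 0 < M) (h : (R - 2) * (R + 1) ≤ 2 * M) (hMM : M ≤ M') :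
    (M : ℚ) * decayProd R M₀ M ≤ (M' : ℚ) * decayProd R M₀ M' := by
  obtain ⟨d, rfl⟩ : ∃ d, M' = M + d := ⟨M' - M, by omega⟩
  induction d with
  | zero => simp
  | succ d ih =>
    calc (M : ℚ) * decayProd R M₀ M ≤ ((M + d : ℕ) : ℚ) * decayProd R M₀ (M + d) := ih (by omega)
      _ ≤ ((M + d + 1 : ℕ) : ℚ) * decayProd R M₀ (M + d + 1) :=
          decay_Z_step R M₀ (M + d) hR (by omega) (by nlinarith)
      _ = ((M + (d + 1) : ℕ) : ℚ) * decayProd R M₀ (M + (d + 1)) := by rw [Nat.add_assoc]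

end PercRepro
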